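import Literature.RingTheory.LocalCohomology.CechComplex
import HarnessLib

/-!
# Base change of the Čech complex along an algebra map

Topic `Literature/RingTheory/LocalCohomology`, sequel of `CechComplex.lean`. For an `R`-algebra
`B`, a `B`-module `M` (an `R`-module by restriction) and `y : Fin s → R` with image
`yB y : Fin s → B`, the localisation `M_{y_t}` formed over `R` and the localisation `M_{ȳ_t}`
formed over `B` are canonically isomorphic as `R`-modules (`cechLocBaseChange`, from Mathlib's
`IsLocalizedModule.restrictScalars_powers` and `IsLocalizedModule.iso`), compatibly with the
restriction maps (`res_cechLocBaseChange`) and hence with the Čech differentials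
(`dC_cechObjBaseChange`) and the augmentation. So the Čech complex — and all its (co)homological
invariants — of a `B`-module may be computed over either ring.

Everything is proved; no named facts. Used to feed the finiteness theorem for `H²_𝔪(J)`
(`CechFiniteness.lean`, stated over the ring `B ⊇ J`) into computations over a regular local
ring `S ↠ B` (`Literature/RingTheory/RegularLocalRing/GrothendieckSamuelHypersurface*`).

## References

* [Grothendieck1968SGA2] A. Grothendieck, SGA 2, Exp. II (arXiv:math/0511279).
* [Eisenbud2005] D. Eisenbud, *The Geometry of Syzygies*, GTM 229, Appendix 1, Thm. A1.3.
-/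

noncomputable section

open CategoryTheory AlgebraicTopology

universe u

namespace Literature.RingTheory.LocalCohomology

variable {R : Type u} [CommRing R] (B : Type u) [CommRing B] [Algebra R B] {s : ℕ}
  (y : Fin s → R) (M : Type u) [AddCommGroup M] [Module R M] [Module B M] [IsScalarTower R B M]

/-- The image family `ȳ_i = algebraMap R B (y_i)`. [folklore] -/
abbrev yB : Fin s → B := fun i => algebraMap R B (y i)

/-- `ȳ_t = algebraMap (y_t)`. [folklore] -/
theorem tupleProd_yB {n : ℕ} (t : Fin n → Fin s) :
    tupleProd (yB B y) t = algebraMap R B (tupleProd y t) := by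
  simp [tupleProd, map_prod]

/-- `M → M_{ȳ_t}` (restricted to `R`) is a localisation at the powers of `y_t`. [folklore] -/
instance isLocalizedModule_mkLinearMap_yB {n : ℕ} (t : Fin n → Fin s) :
    IsLocalizedModule (Submonoid.powers (tupleProd y t))
      ((LocalizedModule.mkLinearMap (Submonoid.powers (tupleProd (yB B y) t)) M).restrictScalars R) := by
  have : IsLocalizedModule (Submonoid.powers (algebraMap R B (tupleProd y t)))
      (LocalizedModule.mkLinearMap (Submonoid.powers (tupleProd (yB B y) t)) M) := by
    rw [← tupleProd_yB]
    infer_instance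
  exact IsLocalizedModule.restrictScalars_powers _ _

/-- **Base change isomorphism** `M_{y_t} ≅ M_{ȳ_t}` of `R`-modules. [folklore] -/
def cechLocBaseChange {n : ℕ} (t : Fin n → Fin s) : CechLoc y M t ≃ₗ[R] CechLoc (yB B y) M t :=
  IsLocalizedModule.iso (Submonoid.powers (tupleProd y t))
    ((LocalizedModule.mkLinearMap (Submonoid.powers (tupleProd (yB B y) t)) M).restrictScalars R)

/-- `m/1 ↦ m/1`. [folklore] -/
@[simp]
theorem cechLocBaseChange_mk_one {n : ℕ} (t : Fin n → Fin s) (m : M) :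
    cechLocBaseChange B y M t (LocalizedModule.mk m 1) = LocalizedModule.mk m 1 :=
  IsLocalizedModule.iso_mk_one _ _ _

/-- The base change isomorphism restricted along `M → M_{y_t}`. [folklore] -/
theorem cechLocBaseChange_comp_mkLinearMap {n : ℕ} (t : Fin n → Fin s) :
    (cechLocBaseChange B y M t).toLinearMap ∘ₗ
        LocalizedModule.mkLinearMap (Submonoid.powers (tupleProd y t)) M =
      (LocalizedModule.mkLinearMap (Submonoid.powers (tupleProd (yB B y) t)) M).restrictScalars R := by
  apply LinearMap.ext
  intro m
  simp

/-- The powers of `y_u` act invertibly (over `R`) on `M_{ȳ_t}` when `y_u ∣ y_t^K`. [folklore] -/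
theorem isUnit_algebraMap_end_cechLoc_yB_of_dvd {n n' : ℕ} {u : Fin n' → Fin s}
    {t : Fin n → Fin s} (h : ∃ K, tupleProd y u ∣ tupleProd y t ^ K)
    (x : Submonoid.powers (tupleProd y u)) :
    IsUnit (algebraMap R (Module.End R (CechLoc (yB B y) M t)) x) := by
  have h' : ∃ K, tupleProd (yB B y) u ∣ tupleProd (yB B y) t ^ K := by
    obtain ⟨K, hK⟩ := h
    exact ⟨K, by rw [tupleProd_yB, tupleProd_yB, ← map_pow]; exact map_dvd _ hK⟩
  obtain ⟨x, k, rfl⟩ := x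
  have hu := isUnit_algebraMap_end_cechLoc_of_dvd (y := yB B y) (M := M) h'
    ⟨tupleProd (yB B y) u ^ k, k, rfl⟩
  rw [Module.End.isUnit_iff] at hu ⊢
  have heq : ∀ z : CechLoc (yB B y) M t,
      algebraMap R (Module.End R (CechLoc (yB B y) M t)) (tupleProd y u ^ k) z =
        algebraMap B (Module.End B (CechLoc (yB B y) M t)) (tupleProd (yB B y) u ^ k) z := by
    intro z
    rw [Module.algebraMap_end_apply, Module.algebraMap_end_apply,
      ← algebraMap_smul B (tupleProd y u ^ k) z, map_pow, ← tupleProd_yB B y u]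
  constructor
  · intro a b hab
    apply hu.1
    have := hab
    rw [heq, heq] at this
    exact this
  · intro z
    obtain ⟨a, ha⟩ := hu.2 z
    exact ⟨a, by rw [heq]; exact ha⟩

/-- **Base change commutes with restriction.** [folklore] -/
theorem res_cechLocBaseChange {n n' : ℕ} (t : Fin n → Fin s) (θ : Fin n' → Fin n)
    (z : CechLoc y M (t ∘ θ)) :
    res (yB B y) M t θ (cechLocBaseChange B y M (t ∘ θ) z) =
      cechLocBaseChange B y M t (res y M t θ z) := by
  have key : (res (yB B y) M t θ).restrictScalars R ∘ₗ (cechLocBaseChange B y M (t ∘ θ)).toLinearMap =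
      (cechLocBaseChange B y M t).toLinearMap ∘ₗ res y M t θ := by
    apply IsLocalizedModule.ext (Submonoid.powers (tupleProd y (t ∘ θ)))
      (LocalizedModule.mkLinearMap (Submonoid.powers (tupleProd y (t ∘ θ))) M)
      (isUnit_algebraMap_end_cechLoc_yB_of_dvd B y M (dvd_comp y t θ))
    apply LinearMap.ext
    intro m
    simp only [LinearMap.coe_comp, Function.comp_apply, LocalizedModule.mkLinearMap_apply,
      LinearEquiv.coe_coe, cechLocBaseChange_mk_one, LinearMap.coe_restrictScalars, res_mk_one]
  exact LinearMap.congr_fun key z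

/-- Base change on cochains. [folklore] -/
def cechObjBaseChange (n : ℕ) : CechObj y M n ≃ₗ[R] CechObj (yB B y) M n :=
  LinearEquiv.piCongrRight fun t => cechLocBaseChange B y M t

/-- Base change on cochains is componentwise. [folklore] -/
theorem cechObjBaseChange_apply (n : ℕ) (c : CechObj y M n) (t : Fin (n + 1) → Fin s) :
    cechObjBaseChange B y M n c t = cechLocBaseChange B y M t (c t) := rfl

/-- **Base change commutes with the Čech differential.** [folklore] -/
theorem dC_cechObjBaseChange (n : ℕ) (c : CechObj y M n) :
    dC n (cechObjBaseChange B y M n c) = cechObjBaseChange B y M (n + 1) (dC n c) := by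
  funext t
  rw [dC_apply, cechObjBaseChange_apply, dC_apply, map_sum]
  refine Finset.sum_congr rfl fun i _ => ?_
  rw [map_zsmul, cechObjBaseChange_apply, res_cechLocBaseChange]

/-- Base change commutes with the augmentation. [folklore] -/
theorem cechAug_cechObjBaseChange (m : M) :
    cechObjBaseChange B y M 0 (cechAug y M m) = cechAug (yB B y) M m := by
  funext t
  rw [cechObjBaseChange_apply, cechAug_apply, cechAug_apply, cechLocBaseChange_mk_one]

end Literature.RingTheory.LocalCohomology

end
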